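import Summits.RiemannHypothesis.RiemannHypothesis.Theorems.PfPersistenceConeTailBound
import HarnessLib

/-!
# PF persistence, fake seat 5 — THEOREM F5-M / F5-PAIR: SIGNED re-weightings beyond the cutoff

Unit `pub-rhpf-fake-5` (gen 5) of the `pub-rhpf` cell — mechanism / rigidity campaign; **no RH claims**.
(FAKES.md §5.8.)

Every tail theorem of the cell so far is ONE-SIGNED: F5-A (one prime dialled,
`PfPersistenceF5TailTwins`), F4-B± (`PfPersistenceConeTailBound`: tables in the down-cone or in the
up-cone of `ζ`'s table `w_ζ(n) = Λ(n)/√n`), F3-B (deletion sets).  Fake family 5 proper — prime-sum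
RE-WEIGHTINGS, in particular MIXED-SIGN ones: mass moved from one site to another (pair swaps),
perturbations `c = w' − w_ζ` with `Σ c(n) = 0` or with any finite list of "sums the windows see"
matched — lies in neither cone.  Here `w'` is an ARBITRARY real table differing from `w_ζ` on a finite
set `S` of sites all BEYOND THE CUTOFF (`log n > 2b` for `n ∈ S`; hence `Q_{w'} = Q_ζ` on every
window `a ≤ b`, `quadratic_eq_zeta_of_beyond_cutoff`), probed with BOTH twins
`T_σ := g₁(· + L/2) − σ g₁(· − L/2)` (`PfPersistenceF5TailTwins.twin (L/2) σ`), `σ = ±1`,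
`L := log n₀ > 2b`, `g₁` a REAL Weil test in `[-b, b]` (no sign condition; the centre `n₀` need not
lie in `S`).  With the real, even autocorrelation profile `A_{g₁}(y) = ∫ g₁(u) g₁(u − y) du`
(`autocorrRe`) and the signed LAG MOMENT
`m(n₀) := Σ_{n ∈ S} (w'(n) − w_ζ(n))·A_{g₁}(log n − log n₀)` (`lagMoment`):

* `signedTwin_re_eq` — EXACT IDENTITY (no positivity hypothesis, any real `σ`):
  `Re Q_{w'}(T_σ) = Re Q_ζ(T_σ) + 2σ·m(n₀)`.
* `signedTwin_re_le` — under Weil positivity of `ζ` on the window `log n₀/2 + b`, `σ² ≤ 1`,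
  `Re Q_ζ(g₁) ≤ ε‖g₁‖₂²`: `Re Q_{w'}(T_σ) ≤ 4ε‖g₁‖₂² + 2σ·m(n₀)` (parallelogram bound of F5-A).
* `signedTwin_negative_or_zeta_not_positive` — THEOREM F5-M (RH-free dichotomy):
  `|m(n₀)| > 2ε‖g₁‖₂² ⟹ ¬ WeilPositivityOn (log n₀/2 + b) ∨ ∃ σ = ±1, Re Q_{w'}(T_σ) < 0`; the sign
  is forced: a SURPLUS `m(n₀) > 0` is killed by the one-signed-type twin `T_{-1} = g₁(·+L/2) + g₁(·−L/2)`,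
  a DEFICIT `m(n₀) < 0` by the odd-type twin `T_{+1}` (F4-B±, now for mixed signs).
* `isolated_negative_or_zeta_not_positive` — sites pairwise `≥ 2b` apart in log-scale: EVERY site
  with `|w'(n₀) − w_ζ(n₀)| > 2ε` carries a negative twin (or `ζ` is not window-positive there),
  WHATEVER the signs elsewhere (`m(n₀) = (w'(n₀) − w_ζ(n₀))‖g₁‖₂²`, `lagMoment_of_isolated`).
* `pair_negative_or_zeta_not_positive` — THEOREM F5-PAIR: two sites `n₁ ≠ n₀` beyond the cutoff,
  arbitrary real changes `c₁, c₀` (a pair SWAP is `c₁c₀ < 0`): since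
  `max(|m(n₀)|, |m(n₁)|) ≥ max(|c₀|, |c₁|)·(‖g₁‖₂² − |A_{g₁}(log n₀ − log n₁)|)` (`two_centre_bound`),
  one of the two windows `log nᵢ/2 + b` carries a negative twin, or `ζ` is not Weil-positive there,
  once `max(|c₀|, |c₁|)·D > 2ε‖g₁‖₂²`, `D := ‖g₁‖₂² − |A_{g₁}(Δ)| ≥ 0` (Bombieri's Lemma 2,
  `abs_autocorrRe_le`), `Δ := log(n₀/n₁)`; for `|Δ| ≥ 2b`, `D = ‖g₁‖₂²` (`autocorrRe_eq_zero_of_le`).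

Reading (FAKES §5.8, GAP F5-SWAP-G; the numbers there are DATA and are not used here): no finite list
of matched linear statistics hides a re-weighting beyond the cutoff from the windows — detection goes
through the lag profile `A_{g₁}`, i.e. the Gram matrix `A_{g₁}(log nᵢ − log nⱼ)` of the translates
`g₁(· − log nᵢ)`; what can be small is only the MARGIN `D(Δ) = ½‖g₁ − g₁(· − Δ)‖₂²` of a
near-diagonal swap (`Δ` small), the typed residual class being `max|cᵢ|·D(Δ) ≤ 2ε₁^ζ(b)‖g₁‖₂²`.
References: A. Weil 1952; E. Bombieri, Rend. Mat. Acc. Lincei (9) 11 (2000) §4 (Lemma 2 and the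
translation/parallelogram argument).
-/

set_option linter.dupNamespace false  -- the mandated namespace repeats `RiemannHypothesis`

noncomputable section

open scoped ArithmeticFunction ComplexConjugate
open Set MeasureTheory Complex Literature.NumberTheory.LFunctions
open Summit.RiemannHypothesis.RiemannHypothesis.Theorems.PfPersistenceDownCone
open Summit.RiemannHypothesis.RiemannHypothesis.Theorems.PfPersistenceF5TailTwins (twin
  isWeilTest_twin tsupport_twin_subset)
open Summit.RiemannHypothesis.RiemannHypothesis.Theorems.PfPersistenceConeTailBound
open Summit.RiemannHypothesis.RiemannHypothesis.Theorems.PfPersistenceBarrier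
open Summit.RiemannHypothesis.RiemannHypothesis.Theorems.PfPersistenceBarrier.ExplicitDatum

namespace Summit.RiemannHypothesis.RiemannHypothesis.Theorems.PfPersistenceF5SignedTwins

variable {g₁ : ℝ → ℝ} {b : ℝ}

/-! ## §1 The real autocorrelation profile of a real test -/

/-- `A_f(y) := Re (f ⋆ f̃)(y) = ∫ f(u) f(u − y) du` for a real test `f`. [folklore] -/
def autocorrRe (f : ℝ → ℝ) (y : ℝ) : ℝ :=
  (weilConv (fun t ↦ (f t : ℂ)) (weilReflect fun t ↦ (f t : ℂ)) y).re

/-- `(f ⋆ f̃)(y) = A_f(y)` as a complex number (the autocorrelation of a real test is real). [folklore] -/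
theorem weilConv_weilReflect_eq_autocorrRe (f : ℝ → ℝ) (y : ℝ) :
    weilConv (fun t ↦ (f t : ℂ)) (weilReflect fun t ↦ (f t : ℂ)) y = ((autocorrRe f y : ℝ) : ℂ) := by
  unfold autocorrRe
  rw [weilConv_weilReflect_ofReal, Complex.ofReal_re]

/-- `A_f(y) = ∫ f(u) f(u − y) du`. [folklore] -/
theorem autocorrRe_eq_integral (f : ℝ → ℝ) (y : ℝ) : autocorrRe f y = ∫ u, f u * f (u - y) := by
  unfold autocorrRe
  rw [weilConv_weilReflect_ofReal, Complex.ofReal_re]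

/-- `A_f` is EVEN: `A_f(−y) = A_f(y)` (`f ⋆ f̃` is conjugation-symmetric, and real here). [folklore] -/
theorem autocorrRe_neg (f : ℝ → ℝ) (y : ℝ) : autocorrRe f (-y) = autocorrRe f y := by
  have h := conj_weilConv_weilReflect_neg (fun t ↦ (f t : ℂ)) y
  rw [weilConv_weilReflect_eq_autocorrRe, weilConv_weilReflect_eq_autocorrRe,
    Complex.conj_ofReal] at h
  exact_mod_cast h

/-- `A_f(0) = ‖f‖₂²`. [folklore] -/
theorem autocorrRe_zero (f : ℝ → ℝ) : autocorrRe f 0 = ∫ x, ‖(f x : ℂ)‖ ^ 2 := by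
  rw [autocorrRe_eq_integral]
  refine integral_congr_ae (Filter.Eventually.of_forall fun u ↦ ?_)
  simp only [sub_zero, Complex.norm_real, Real.norm_eq_abs, sq_abs]
  ring

/-- Bombieri's Lemma 2 (Cauchy–Schwarz): `|A_f(y)| ≤ ‖f‖₂²`. [cite: Bombieri2000Weil, §4 Lemma 2] -/
theorem abs_autocorrRe_le (hg : IsWeilTest fun t ↦ (g₁ t : ℂ)) (y : ℝ) :
    |autocorrRe g₁ y| ≤ ∫ x, ‖(g₁ x : ℂ)‖ ^ 2 := by
  have h := norm_weilConv_weilReflect_le hg y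
  rwa [weilConv_weilReflect_eq_autocorrRe, Complex.norm_real, Real.norm_eq_abs] at h

/-- `A_f` vanishes at lags `|y| ≥ 2b` when `f ⊆ [-b, b]`. [folklore] -/
theorem autocorrRe_eq_zero_of_le (hg : IsWeilTest fun t ↦ (g₁ t : ℂ))
    (hs : tsupport (fun t ↦ (g₁ t : ℂ)) ⊆ Icc (-b) b) {y : ℝ} (hy : 2 * b ≤ |y|) :
    autocorrRe g₁ y = 0 := by
  have hk : IsWeilTest (weilConv (fun t ↦ (g₁ t : ℂ)) (weilReflect fun t ↦ (g₁ t : ℂ))) :=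
    hg.weilConv hg.weilReflect
  have hIoo := support_subset_Ioo_of_tsupport_subset_Icc hk.1.continuous
    (tsupport_weilConv_weilReflect_subset (a := b) hg.2 hs)
  have hz : weilConv (fun t ↦ (g₁ t : ℂ)) (weilReflect fun t ↦ (g₁ t : ℂ)) y = 0 := by
    by_contra hne
    have hmem := hIoo (Function.mem_support.2 hne)
    rw [mem_Ioo] at hmem
    have : |y| < 2 * b := abs_lt.2 ⟨by linarith [hmem.1], hmem.2⟩
    linarith
  unfold autocorrRe
  rw [hz, Complex.zero_re]

/-! ## §2 The family: finitely many sites re-weighted beyond the cutoff; its lag moments -/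

/-- **Invisible below the cutoff.** `w' = w_ζ` off `S` and `log n > 2b` on `S` `⟹ Q_{w'}(g) = Q_ζ(g)`
for every test `g ⊆ [-a, a]`, `a ≤ b` (the tree's locality `quadratic_eq_of_agreeBelow`). [folklore] -/
theorem quadratic_eq_zeta_of_beyond_cutoff {w' : ℕ → ℝ} {S : Finset ℕ} {a : ℝ}
    (hoff : ∀ n ∉ S, w' n = zetaTable n) (hS : ∀ n ∈ S, 2 * b < Real.log n) (ha : a ≤ b)
    {g : ℝ → ℂ} (hg : tsupport g ⊆ Icc (-a) a) :
    (tableDatum w').quadratic g = weilQuadratic g := by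
  have hagree : AgreeBelow (tableDatum w') (tableDatum zetaTable) (2 * b) :=
    agreeBelow_tableDatum fun n hn ↦ by
      by_cases hnS : n ∈ S
      · exact absurd ((le_abs_self _).trans hn) (not_le.2 (hS n hnS))
      · exact hoff n hnS
  rw [quadratic_eq_of_agreeBelow hagree rfl ha hg, tableDatum_zetaTable_quadratic]

/-- The signed LAG MOMENT of the re-weighting `w' − w_ζ` on `S` seen from the centre `log n₀` through
the profile `A_{g₁}`: `m(n₀) = Σ_{n ∈ S} (w'(n) − w_ζ(n))·A_{g₁}(log n − log n₀)`. [folklore] -/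
def lagMoment (S : Finset ℕ) (w' : ℕ → ℝ) (g₁ : ℝ → ℝ) (n₀ : ℕ) : ℝ :=
  ∑ n ∈ S, (w' n - zetaTable n) * autocorrRe g₁ (Real.log n - Real.log n₀)

/-- **Isolated centre.** If every other site of `S` is `≥ 2b` away from `n₀ ∈ S` in log-scale, only
`n₀` enters: `m(n₀) = (w'(n₀) − w_ζ(n₀))·‖g₁‖₂²`. [folklore] -/
theorem lagMoment_of_isolated {S : Finset ℕ} {w' : ℕ → ℝ} {n₀ : ℕ} (hn₀ : n₀ ∈ S)
    (hg : IsWeilTest fun t ↦ (g₁ t : ℂ)) (hs : tsupport (fun t ↦ (g₁ t : ℂ)) ⊆ Icc (-b) b)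
    (hiso : ∀ n ∈ S, n ≠ n₀ → 2 * b ≤ |Real.log n - Real.log n₀|) :
    lagMoment S w' g₁ n₀ = (w' n₀ - zetaTable n₀) * ∫ x, ‖(g₁ x : ℂ)‖ ^ 2 := by
  unfold lagMoment
  rw [← Finset.add_sum_erase S _ hn₀, sub_self, autocorrRe_zero]
  have h0 : ∑ n ∈ S.erase n₀, (w' n - zetaTable n) * autocorrRe g₁ (Real.log n - Real.log n₀) = 0 :=
    Finset.sum_eq_zero fun n hn ↦ by
      rw [autocorrRe_eq_zero_of_le hg hs
        (hiso n (Finset.mem_of_mem_erase hn) (Finset.ne_of_mem_erase hn)), mul_zero]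
  rw [h0, add_zero]

/-- The two lag moments of a two-site re-weighting `{n₁, n₀}` (`cᵢ := w'(nᵢ) − w_ζ(nᵢ)`), seen from
`n₀`: `m(n₀) = c₀‖g₁‖₂² + c₁·A_{g₁}(log n₀ − log n₁)`. [folklore] -/
theorem lagMoment_pair {w' : ℕ → ℝ} {n₀ n₁ : ℕ} (hne : n₁ ≠ n₀) (g₁ : ℝ → ℝ) :
    lagMoment {n₁, n₀} w' g₁ n₀ = (w' n₀ - zetaTable n₀) * (∫ x, ‖(g₁ x : ℂ)‖ ^ 2) +
      (w' n₁ - zetaTable n₁) * autocorrRe g₁ (Real.log n₀ - Real.log n₁) := by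
  unfold lagMoment
  rw [Finset.sum_pair hne, sub_self, autocorrRe_zero,
    show Real.log (n₁ : ℝ) - Real.log (n₀ : ℝ) = -(Real.log (n₀ : ℝ) - Real.log (n₁ : ℝ)) by ring,
    autocorrRe_neg]
  ring

/-- … and seen from `n₁`: `m(n₁) = c₁‖g₁‖₂² + c₀·A_{g₁}(log n₀ − log n₁)`. [folklore] -/
theorem lagMoment_pair' {w' : ℕ → ℝ} {n₀ n₁ : ℕ} (hne : n₁ ≠ n₀) (g₁ : ℝ → ℝ) :
    lagMoment {n₁, n₀} w' g₁ n₁ = (w' n₁ - zetaTable n₁) * (∫ x, ‖(g₁ x : ℂ)‖ ^ 2) +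
      (w' n₀ - zetaTable n₀) * autocorrRe g₁ (Real.log n₀ - Real.log n₁) := by
  unfold lagMoment
  rw [Finset.sum_pair hne, sub_self, autocorrRe_zero]

/-! ## §3 THEOREM F5-M: the exact signed twin identity, the bound, the RH-free dichotomy -/

/-- **EXACT IDENTITY.** `w' = w_ζ` off a finite set `S` of sites beyond the cutoff (`log n > 2b` on
`S`), `L = log n₀ > 2b`, `g₁` real in `[-b, b]`, any real `σ`:
`Re Q_{w'}(T_σ) = Re Q_ζ(T_σ) + 2σ·m(n₀)`, `T_σ = twin (L/2) σ g₁` (off the central lobe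
`A_{T_σ}(±y) = -σA_{g₁}(±(y − L))`, `autocorr_twin_of_lt`; `A_{g₁}` is even). [cite: Bombieri2000Weil, §4] -/
theorem signedTwin_re_eq {w' : ℕ → ℝ} {S : Finset ℕ} {n₀ : ℕ} (hb : 0 < b)
    (hbL : 2 * b < Real.log n₀) (hoff : ∀ n ∉ S, w' n = zetaTable n)
    (hS : ∀ n ∈ S, 2 * b < Real.log n) (hg : IsWeilTest fun t ↦ (g₁ t : ℂ))
    (hs : tsupport (fun t ↦ (g₁ t : ℂ)) ⊆ Icc (-b) b) (σ : ℝ) :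
    ((tableDatum w').quadratic (twin (Real.log n₀ / 2) σ fun t ↦ (g₁ t : ℂ))).re =
      (weilQuadratic (twin (Real.log n₀ / 2) σ fun t ↦ (g₁ t : ℂ))).re
        + 2 * σ * lagMoment S w' g₁ n₀ := by
  obtain ⟨c, hc_def⟩ : ∃ c : ℝ, c = Real.log n₀ / 2 := ⟨_, rfl⟩
  rw [← hc_def]
  have hc2 : 2 * c = Real.log n₀ := by rw [hc_def]; ring
  have hc0 : 0 ≤ c := by linarith
  have hTw : IsWeilTest (twin c σ fun t ↦ (g₁ t : ℂ)) := isWeilTest_twin hg c σ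
  have hwin := le_log_floor_succ_half (c + b)
  obtain ⟨N, hN⟩ : ∃ N : ℕ, N = ⌊Real.exp (2 * (c + b))⌋₊ := ⟨_, rfl⟩
  rw [← hN] at hwin
  have hTs : tsupport (twin c σ fun t ↦ (g₁ t : ℂ)) ⊆
      Icc (-(Real.log ((N : ℝ) + 1) / 2)) (Real.log ((N : ℝ) + 1) / 2) :=
    (tsupport_twin_subset hs hc0 σ).trans (Icc_subset_Icc (by linarith) hwin)
  rw [tableDatum_quadratic_eq_add_sum zetaTable w' hTw N hTs, tableDatum_zetaTable_quadratic,
    Complex.add_re, Complex.re_sum]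
  congr 1
  -- the summand, termwise on the range
  have hterm : ∀ n ∈ Finset.range (N + 1),
      (((zetaTable n - w' n : ℝ) : ℂ) * (weilConv (twin c σ fun t ↦ (g₁ t : ℂ))
          (weilReflect (twin c σ fun t ↦ (g₁ t : ℂ))) (Real.log n) +
        weilConv (twin c σ fun t ↦ (g₁ t : ℂ)) (weilReflect (twin c σ fun t ↦ (g₁ t : ℂ)))
          (-Real.log n))).re =
        2 * σ * ((w' n - zetaTable n) * autocorrRe g₁ (Real.log n - Real.log n₀)) := by
    intro n _
    by_cases hnS : n ∈ S
    · have hlo : 2 * b < Real.log n := hS n hnS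
      rw [autocorr_twin_of_lt hs hb hc0 σ hlo, autocorr_twin_neg_of_lt hs hb hc0 σ hlo,
        show 2 * c - Real.log n = -(Real.log n - 2 * c) by ring,
        weilConv_weilReflect_eq_autocorrRe, weilConv_weilReflect_eq_autocorrRe, autocorrRe_neg,
        hc2]
      have e : ((zetaTable n - w' n : ℝ) : ℂ) *
          (-(σ : ℂ) * ((autocorrRe g₁ (Real.log n - Real.log n₀) : ℝ) : ℂ) +
            -(σ : ℂ) * ((autocorrRe g₁ (Real.log n - Real.log n₀) : ℝ) : ℂ)) =
          (((zetaTable n - w' n) * (-(2 * σ * autocorrRe g₁ (Real.log n - Real.log n₀))) : ℝ) :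
            ℂ) := by
        push_cast; ring
      rw [e, Complex.ofReal_re]
      ring
    · have hw : w' n = zetaTable n := hoff n hnS
      simp [hw]
  rw [Finset.sum_congr rfl hterm, ← Finset.mul_sum]
  congr 1
  -- both sums are the sum over `range ∩ S`
  have h1 : ∑ n ∈ Finset.range (N + 1) ∩ S,
      (w' n - zetaTable n) * autocorrRe g₁ (Real.log n - Real.log n₀) =
      ∑ n ∈ Finset.range (N + 1), (w' n - zetaTable n) * autocorrRe g₁ (Real.log n - Real.log n₀) :=
    Finset.sum_subset Finset.inter_subset_left fun n hnr hn ↦ by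
      have hnS : n ∉ S := fun h' ↦ hn (Finset.mem_inter.2 ⟨hnr, h'⟩)
      rw [hoff n hnS, sub_self, zero_mul]
  have h2 : ∑ n ∈ Finset.range (N + 1) ∩ S,
      (w' n - zetaTable n) * autocorrRe g₁ (Real.log n - Real.log n₀) = lagMoment S w' g₁ n₀ :=
    Finset.sum_subset Finset.inter_subset_right fun n hnS hn ↦ by
      have hnr : n ∉ Finset.range (N + 1) := fun h' ↦ hn (Finset.mem_inter.2 ⟨h', hnS⟩)
      rw [Finset.mem_range, not_lt] at hnr
      have hn' : (N : ℝ) + 1 ≤ n := by exact_mod_cast hnr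
      have hlog : Real.log ((N : ℝ) + 1) ≤ Real.log n := Real.log_le_log (by positivity) hn'
      have hy : 2 * b ≤ |Real.log n - Real.log n₀| := by
        rw [abs_of_nonneg (by linarith)]
        linarith
      rw [autocorrRe_eq_zero_of_le hg hs hy, mul_zero]
  rw [← h1, h2]

/-- **BOUND under window positivity.** `σ² ≤ 1`, `Re Q_ζ(g₁) ≤ ε‖g₁‖₂²`, `ζ` Weil-positive on the
window `log n₀/2 + b` `⟹ Re Q_{w'}(T_σ) ≤ 4ε‖g₁‖₂² + 2σ·m(n₀)`. [cite: Bombieri2000Weil, §4] -/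
theorem signedTwin_re_le {w' : ℕ → ℝ} {S : Finset ℕ} {n₀ : ℕ} {ε σ : ℝ} (hb : 0 < b)
    (hbL : 2 * b < Real.log n₀) (hoff : ∀ n ∉ S, w' n = zetaTable n)
    (hS : ∀ n ∈ S, 2 * b < Real.log n) (hσ : σ ^ 2 ≤ 1)
    (hW : WeilPositivityOn (Real.log n₀ / 2 + b))
    (hg : IsWeilTest fun t ↦ (g₁ t : ℂ)) (hs : tsupport (fun t ↦ (g₁ t : ℂ)) ⊆ Icc (-b) b)
    (hq : (weilQuadratic fun t ↦ (g₁ t : ℂ)).re ≤ ε * ∫ x, ‖(g₁ x : ℂ)‖ ^ 2) :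
    ((tableDatum w').quadratic (twin (Real.log n₀ / 2) σ fun t ↦ (g₁ t : ℂ))).re ≤
      4 * (ε * ∫ x, ‖(g₁ x : ℂ)‖ ^ 2) + 2 * σ * lagMoment S w' g₁ n₀ := by
  rw [signedTwin_re_eq hb hbL hoff hS hg hs σ]
  have hc0 : (0 : ℝ) ≤ Real.log n₀ / 2 := by linarith
  have h := re_weilQuadratic_twin_le (c := Real.log n₀ / 2) hg hs hc0 hσ hq hW
  linarith

/-- **THEOREM F5-M (RH-free dichotomy for signed re-weightings beyond the cutoff), PROVED.**
`|m(n₀)| > 2ε‖g₁‖₂² ⟹` either `ζ` is not Weil-positive on the window `log n₀/2 + b`, or one of the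
two twins `T_{±1}` is a negative direction of `Q_{w'}` there (`σ = -1` for a surplus `m(n₀) ≥ 0`,
`σ = +1` for a deficit). [cite: Bombieri2000Weil, §4] -/
theorem signedTwin_negative_or_zeta_not_positive {w' : ℕ → ℝ} {S : Finset ℕ} {n₀ : ℕ} {ε : ℝ}
    (hb : 0 < b) (hbL : 2 * b < Real.log n₀) (hoff : ∀ n ∉ S, w' n = zetaTable n)
    (hS : ∀ n ∈ S, 2 * b < Real.log n)
    (hg : IsWeilTest fun t ↦ (g₁ t : ℂ)) (hs : tsupport (fun t ↦ (g₁ t : ℂ)) ⊆ Icc (-b) b)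
    (hq : (weilQuadratic fun t ↦ (g₁ t : ℂ)).re ≤ ε * ∫ x, ‖(g₁ x : ℂ)‖ ^ 2)
    (hε : 2 * (ε * ∫ x, ‖(g₁ x : ℂ)‖ ^ 2) < |lagMoment S w' g₁ n₀|) :
    ¬ WeilPositivityOn (Real.log n₀ / 2 + b) ∨
      ∃ σ : ℝ, σ ^ 2 = 1 ∧
        ((tableDatum w').quadratic (twin (Real.log n₀ / 2) σ fun t ↦ (g₁ t : ℂ))).re < 0 := by
  by_cases hW : WeilPositivityOn (Real.log n₀ / 2 + b)
  · refine Or.inr ?_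
    by_cases hm : 0 ≤ lagMoment S w' g₁ n₀
    · refine ⟨-1, by norm_num, ?_⟩
      have h := signedTwin_re_le (σ := -1) hb hbL hoff hS (by norm_num) hW hg hs hq
      rw [abs_of_nonneg hm] at hε
      linarith
    · refine ⟨1, by norm_num, ?_⟩
      have h := signedTwin_re_le (σ := 1) hb hbL hoff hS (by norm_num) hW hg hs hq
      rw [abs_of_neg (not_le.1 hm)] at hε
      linarith
  · exact Or.inl hW

/-- **Isolated sites, any signs.** Every other site of `S` at log-distance `≥ 2b` from `n₀ ∈ S`,
`‖g₁‖₂ > 0`, `|w'(n₀) − w_ζ(n₀)| > 2ε` `⟹` the F5-M dichotomy at the window `log n₀/2 + b` —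
whatever the signs and sizes of the other changes (for sites pairwise `≥ 2b` apart this holds at
EVERY site; F5-A and F4-B± needed one-signedness instead). [cite: Bombieri2000Weil, §4] -/
theorem isolated_negative_or_zeta_not_positive {w' : ℕ → ℝ} {S : Finset ℕ} {n₀ : ℕ} {ε : ℝ}
    (hb : 0 < b) (hbL : 2 * b < Real.log n₀) (hoff : ∀ n ∉ S, w' n = zetaTable n)
    (hS : ∀ n ∈ S, 2 * b < Real.log n) (hn₀ : n₀ ∈ S)
    (hiso : ∀ n ∈ S, n ≠ n₀ → 2 * b ≤ |Real.log n - Real.log n₀|)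
    (hg : IsWeilTest fun t ↦ (g₁ t : ℂ)) (hs : tsupport (fun t ↦ (g₁ t : ℂ)) ⊆ Icc (-b) b)
    (hq : (weilQuadratic fun t ↦ (g₁ t : ℂ)).re ≤ ε * ∫ x, ‖(g₁ x : ℂ)‖ ^ 2)
    (hpos : 0 < ∫ x, ‖(g₁ x : ℂ)‖ ^ 2) (hε : 2 * ε < |w' n₀ - zetaTable n₀|) :
    ¬ WeilPositivityOn (Real.log n₀ / 2 + b) ∨
      ∃ σ : ℝ, σ ^ 2 = 1 ∧
        ((tableDatum w').quadratic (twin (Real.log n₀ / 2) σ fun t ↦ (g₁ t : ℂ))).re < 0 := by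
  refine signedTwin_negative_or_zeta_not_positive hb hbL hoff hS hg hs hq ?_
  rw [lagMoment_of_isolated hn₀ hg hs hiso, abs_mul, abs_of_pos hpos]
  nlinarith

/-! ## §4 THEOREM F5-PAIR: two-site re-weightings (pair swaps) -/

/-- `|x| − |y| ≤ |x + y|`. [folklore] -/
theorem abs_sub_abs_le_abs_add (x y : ℝ) : |x| - |y| ≤ |x + y| := by
  simpa [abs_neg, sub_neg_eq_add] using abs_sub_abs_le_abs_sub x (-y)

/-- **Two-centre bound** (pure inequality): for `N ≥ 0`,
`max(|c₀|, |c₁|)·(N − |A|) ≤ max(|c₀N + c₁A|, |c₁N + c₀A|)`. [folklore] -/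
theorem two_centre_bound (c₀ c₁ Nm A : ℝ) (hNm : 0 ≤ Nm) :
    max |c₀| |c₁| * (Nm - |A|) ≤ max |c₀ * Nm + c₁ * A| |c₁ * Nm + c₀ * A| := by
  have h0 : |c₀| * Nm - |c₁| * |A| ≤ |c₀ * Nm + c₁ * A| := by
    calc |c₀| * Nm - |c₁| * |A| = |c₀ * Nm| - |c₁ * A| := by
          rw [abs_mul, abs_mul, abs_of_nonneg hNm]
      _ ≤ |c₀ * Nm + c₁ * A| := abs_sub_abs_le_abs_add _ _
  have h1 : |c₁| * Nm - |c₀| * |A| ≤ |c₁ * Nm + c₀ * A| := by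
    calc |c₁| * Nm - |c₀| * |A| = |c₁ * Nm| - |c₀ * A| := by
          rw [abs_mul, abs_mul, abs_of_nonneg hNm]
      _ ≤ |c₁ * Nm + c₀ * A| := abs_sub_abs_le_abs_add _ _
  have hA := abs_nonneg A
  rcases le_total |c₁| |c₀| with h | h
  · rw [max_eq_left h]
    have : |c₁| * |A| ≤ |c₀| * |A| := mul_le_mul_of_nonneg_right h hA
    calc |c₀| * (Nm - |A|) ≤ |c₀| * Nm - |c₁| * |A| := by nlinarith
      _ ≤ _ := h0.trans (le_max_left _ _)
  · rw [max_eq_right h]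
    have : |c₀| * |A| ≤ |c₁| * |A| := mul_le_mul_of_nonneg_right h hA
    calc |c₁| * (Nm - |A|) ≤ |c₁| * Nm - |c₀| * |A| := by nlinarith
      _ ≤ _ := h1.trans (le_max_right _ _)

/-- **The two centres of a pair.** `max(|m(n₀)|, |m(n₁)|) ≥ max(|c₀|, |c₁|)·(‖g₁‖₂² − |A_{g₁}(log n₀ − log n₁)|)`
for the two-site re-weighting `{n₁, n₀}`. [folklore] -/
theorem abs_lagMoment_pair_ge {w' : ℕ → ℝ} {n₀ n₁ : ℕ} (hne : n₁ ≠ n₀) (g₁ : ℝ → ℝ) :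
    max |w' n₀ - zetaTable n₀| |w' n₁ - zetaTable n₁| *
        ((∫ x, ‖(g₁ x : ℂ)‖ ^ 2) - |autocorrRe g₁ (Real.log n₀ - Real.log n₁)|) ≤
      max |lagMoment {n₁, n₀} w' g₁ n₀| |lagMoment {n₁, n₀} w' g₁ n₁| := by
  rw [lagMoment_pair hne, lagMoment_pair' hne]
  exact two_centre_bound _ _ _ _ (integral_nonneg fun x ↦ by positivity)

/-- **THEOREM F5-PAIR (two-site re-weightings / pair swaps beyond the cutoff), PROVED.**  `w' = w_ζ`
except at `n₁ ≠ n₀`, both with `log nᵢ > 2b`, arbitrary real changes `cᵢ = w'(nᵢ) − w_ζ(nᵢ)`; `g₁` real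
in `[-b, b]` with `Re Q_ζ(g₁) ≤ ε‖g₁‖₂²`.  If `max(|c₀|, |c₁|)·(‖g₁‖₂² − |A_{g₁}(log n₀ − log n₁)|) >
2ε‖g₁‖₂²` then at one of the two windows `log nᵢ/2 + b` either `ζ` is not Weil-positive or a twin
`T_{±1}` centred at `nᵢ` is a negative direction of `Q_{w'}`. [cite: Bombieri2000Weil, §4] -/
theorem pair_negative_or_zeta_not_positive {w' : ℕ → ℝ} {n₀ n₁ : ℕ} {ε : ℝ} (hb : 0 < b)
    (hne : n₁ ≠ n₀) (hb1 : 2 * b < Real.log n₁) (hb0 : 2 * b < Real.log n₀)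
    (hoff : ∀ n : ℕ, n ≠ n₁ → n ≠ n₀ → w' n = zetaTable n)
    (hg : IsWeilTest fun t ↦ (g₁ t : ℂ)) (hs : tsupport (fun t ↦ (g₁ t : ℂ)) ⊆ Icc (-b) b)
    (hq : (weilQuadratic fun t ↦ (g₁ t : ℂ)).re ≤ ε * ∫ x, ‖(g₁ x : ℂ)‖ ^ 2)
    (hε : 2 * (ε * ∫ x, ‖(g₁ x : ℂ)‖ ^ 2) <
      max |w' n₀ - zetaTable n₀| |w' n₁ - zetaTable n₁| *
        ((∫ x, ‖(g₁ x : ℂ)‖ ^ 2) - |autocorrRe g₁ (Real.log n₀ - Real.log n₁)|)) :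
    ∃ m ∈ ({n₀, n₁} : Finset ℕ), ¬ WeilPositivityOn (Real.log m / 2 + b) ∨
      ∃ σ : ℝ, σ ^ 2 = 1 ∧
        ((tableDatum w').quadratic (twin (Real.log m / 2) σ fun t ↦ (g₁ t : ℂ))).re < 0 := by
  have hoff' : ∀ n ∉ ({n₁, n₀} : Finset ℕ), w' n = zetaTable n := by
    intro n hn
    rw [Finset.mem_insert, Finset.mem_singleton, not_or] at hn
    exact hoff n hn.1 hn.2
  have hS : ∀ n ∈ ({n₁, n₀} : Finset ℕ), 2 * b < Real.log n := by
    intro n hn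
    rw [Finset.mem_insert, Finset.mem_singleton] at hn
    rcases hn with rfl | rfl <;> assumption
  have hkey := lt_of_lt_of_le hε (abs_lagMoment_pair_ge hne g₁ (w' := w'))
  rcases lt_max_iff.1 hkey with h0 | h1
  · exact ⟨n₀, by simp, signedTwin_negative_or_zeta_not_positive hb hb0 hoff' hS hg hs hq h0⟩
  · exact ⟨n₁, by simp, signedTwin_negative_or_zeta_not_positive hb hb1 hoff' hS hg hs hq h1⟩

/-- **Far pairs: full margin.** If moreover `|log n₀ − log n₁| ≥ 2b` then `A_{g₁}(log n₀ − log n₁) = 0`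
and the threshold is `max(|c₀|, |c₁|) > 2ε` (`‖g₁‖₂ > 0`). [cite: Bombieri2000Weil, §4] -/
theorem farPair_negative_or_zeta_not_positive {w' : ℕ → ℝ} {n₀ n₁ : ℕ} {ε : ℝ} (hb : 0 < b)
    (hne : n₁ ≠ n₀) (hb1 : 2 * b < Real.log n₁) (hb0 : 2 * b < Real.log n₀)
    (hfar : 2 * b ≤ |Real.log n₀ - Real.log n₁|)
    (hoff : ∀ n : ℕ, n ≠ n₁ → n ≠ n₀ → w' n = zetaTable n)
    (hg : IsWeilTest fun t ↦ (g₁ t : ℂ)) (hs : tsupport (fun t ↦ (g₁ t : ℂ)) ⊆ Icc (-b) b)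
    (hq : (weilQuadratic fun t ↦ (g₁ t : ℂ)).re ≤ ε * ∫ x, ‖(g₁ x : ℂ)‖ ^ 2)
    (hpos : 0 < ∫ x, ‖(g₁ x : ℂ)‖ ^ 2) (hε : 2 * ε < max |w' n₀ - zetaTable n₀| |w' n₁ - zetaTable n₁|) :
    ∃ m ∈ ({n₀, n₁} : Finset ℕ), ¬ WeilPositivityOn (Real.log m / 2 + b) ∨
      ∃ σ : ℝ, σ ^ 2 = 1 ∧
        ((tableDatum w').quadratic (twin (Real.log m / 2) σ fun t ↦ (g₁ t : ℂ))).re < 0 := by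
  refine pair_negative_or_zeta_not_positive hb hne hb1 hb0 hoff hg hs hq ?_
  rw [autocorrRe_eq_zero_of_le hg hs hfar, abs_zero, sub_zero]
  nlinarith

end Summit.RiemannHypothesis.RiemannHypothesis.Theorems.PfPersistenceF5SignedTwins

end
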